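import Summits.QuantumFields.BalabanUV.Beta.GraphHarmonicExtension

/-!
# `Summit.QuantumFields.BalabanUV.Beta.GraphPoissonKernel` — the POISSON KERNEL of the free weighted graph Laplacian on a finite set
# carrying a unit supersolution (nonnegative, total mass one, the Poisson representation of the harmonic extension, support on the
# exterior boundary) and the DOMINATION of every sub-solution by the Poisson integral of its exterior values — step 1b of road P3's
# reduction of the mean-value binder (MV) of O.2 item (ii-b) to ONE pointwise Poisson-kernel bound (generic finite bond structure)

HONEST FRAMING (page 1 of everything in this cell).  Discharging `FlowStep.BetaPertH` would make Bałaban's ultraviolet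
stability UNCONDITIONAL — a constructive-QFT result; it is NOT the continuum limit and NOT the Clay problem.  This module
discharges nothing of `BetaPertH`; it is [folklore] finite-dimensional linear algebra and order bookkeeping on a finite bond structure,
kernel-checked, by CO-OWNER #3 of binder row D4 (unit `b2b-balaban-beta-d4-p3`, road P3 «reduction road», gen 12).  HONEST DEPENDENCY:
continuum YM on T⁴ ⇐ BetaPertH ∧ nine spine estimates (0/9 proved); BetaPertH ⇐ (D1) ∧ (D4) ∧ CAP+tail; G-an2-4 gates asym, D1 and NE2/3/4.

THE POINT (continued from `GraphHarmonicExtension`).  With the harmonic extension `harmExt B g` in hand (any finite bond structure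
`src, tgt : Bd → St`, weights `c`, `W`∕`N` written out as in files 12∕14, `B` carrying a nonnegative unit supersolution `w₀`):
* §3 the POISSON KERNEL **`poisson B x y := harmExt B δ_y x`** — the tree's counterpart of the hitting distribution
  `P^x{S_{τ_B} = y}` ∕ of «the unique function harmonic on `B` equal to `δ(· − y)` off `B`» (Lawler–Limic 2010, p. 123): `poisson_nonneg`,
  `poisson_le_one`, `poisson_eq_zero_of_mem` (interior columns vanish), `poisson_of_not_mem` (identity rows off `B`), the
  representation **`harmExt_eq_sum_poisson`** `harmExt B g x = Σ_{y ∉ B} poisson B x y · g y`, total mass **`sum_poisson_eq_one`**, and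
  support on the exterior boundary **`poisson_eq_zero_of_not_adj`** (`poisson B x y = 0` for `x ∈ B` when no bond joins `y ∉ B` to `B`);
* §4 **`subsolution_le_harmExt`** ∕ **`subsolution_le_poisson_sum`** ∕ **`subsolution_le_mul_sum`** — DOMINATION: `W·z ≤ Nz` on `B`
  gives `z(x) ≤ harmExt B z x = Σ_{y ∉ B} poisson B x y · z(y)`, and `≤ K·Σ_{y∉B} z(y)` under a pointwise bound `poisson B x · ≤ K` for
  `z ≥ 0` off `B` — the shape in which a harmonic-measure bound `K ≍ s^{1−d}` on a lattice ball of radius `s` is consumed by the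
  radius-averaging step («MV-FROM-HARMONIC-MEASURE», next);
* §5 a witness on the one-bond graph.
NOT here: any bound on `poisson` (the harmonic-measure bound is the residual LEAF), the lattice shells, the averaging.  (MV) and the
Poisson bound remain HYPOTHESES of the cell until a leaf is typed and cross-read (ABSOLUTE RULE).

LOCATORS (shape only, nothing printed asserted; ABSOLUTE RULE): [Balaban1985BackgroundPropagators] Thm 3.1 (3.42) p. 397, p. 394
(`Ω₀Δ′Ω₀`, `G′`); [Balaban1984PropagatorsII] Prop. 2.2 (2.67) p. 234.  Row D4: NO class change (critical-path width 0; D4 DISCHARGE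
NO DATE); NOT BetaPertH, NOT continuum, NOT Clay, NOT summit progress.
-/

open scoped BigOperators
open Finset

namespace Summit.QuantumFields.BalabanUV.Beta.GraphPoissonKernel

open Summit.QuantumFields.BalabanUV.Beta.SubsolutionMeanValue (nb_sub nb_smul nb_mono nb_nonneg)
open Summit.QuantumFields.BalabanUV.Beta.GraphHarmonicExtension

noncomputable section

variable {St Bd : Type} [Fintype St] [Fintype Bd] [DecidableEq St] (src tgt : Bd → St) (c : Bd → ℝ)

/-! ## §3 The Poisson kernel -/

/-- **The POISSON KERNEL** of `B`: `poisson B x y = harmExt B δ_y x`, the value at `x` of the harmonic extension of the indicator of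
the single exterior site `y` — the tree's counterpart of the hitting distribution `P^x{S_{τ_B} = y}` (for `y ∉ B`; for `y ∈ B` the datum
vanishes off `B` and so does the kernel). MODEL object. [folklore] -/
def poisson (B : Finset St) (x y : St) : ℝ := harmExt src tgt c B (fun z => if z = y then 1 else 0) x

section Kernel

variable (B : Finset St) (w₀ : St → ℝ) (hw₀0 : ∀ y, 0 ≤ w₀ y)
    (hw₀ : ∀ x ∈ B, 1 + ((∑ b ∈ univ.filter (fun b => tgt b = x), c b ^ 2 * w₀ (src b)) +
        ∑ b ∈ univ.filter (fun b => src b = x), c b ^ 2 * w₀ (tgt b)) ≤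
      ((∑ b ∈ univ.filter (fun b => tgt b = x), c b ^ 2) + ∑ b ∈ univ.filter (fun b => src b = x), c b ^ 2) * w₀ x)

include hw₀0 hw₀

/-- `poisson B x y ≥ 0`. [folklore] -/
theorem poisson_nonneg (x y : St) : 0 ≤ poisson src tgt c B x y :=
  harmExt_nonneg src tgt c B w₀ hw₀0 hw₀ _ (fun z _ => by positivity) x

/-- `poisson B x y ≤ 1`. [folklore] -/
theorem poisson_le_one (x y : St) : poisson src tgt c B x y ≤ 1 := by
  have h := harmExt_mono src tgt c B w₀ hw₀0 hw₀ (fun z => if z = y then (1 : ℝ) else 0) (fun _ => 1)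
    (fun z _ => by split_ifs <;> norm_num) x
  rw [harmExt_const src tgt c B w₀ hw₀0 hw₀] at h
  exact h

/-- The kernel vanishes at interior columns: for `y ∈ B` the datum `δ_y` vanishes off `B`. [folklore] -/
theorem poisson_eq_zero_of_mem (x y : St) (hy : y ∈ B) : poisson src tgt c B x y = 0 := by
  have h := harmExt_congr_off src tgt c B w₀ hw₀0 hw₀ (fun z => if z = y then (1 : ℝ) else 0) (fun _ => 0)
    (fun z hz => by rw [if_neg]; rintro rfl; exact hz hy)
  rw [poisson, h, harmExt_const src tgt c B w₀ hw₀0 hw₀]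

/-- Off `B` the kernel is the identity: `poisson B x y = δ_{xy}` for `x ∉ B`. [folklore] -/
theorem poisson_of_not_mem (x y : St) (hx : x ∉ B) : poisson src tgt c B x y = if x = y then 1 else 0 := by
  rw [poisson, harmExt_eq_off src tgt c B w₀ hw₀0 hw₀ _ x hx]

/-- **THE POISSON REPRESENTATION**: `harmExt B g x = Σ_{y ∉ B} poisson B x y · g y`. [folklore] -/
theorem harmExt_eq_sum_poisson (g : St → ℝ) (x : St) :
    harmExt src tgt c B g x = ∑ y ∈ univ.filter (fun y => y ∉ B), poisson src tgt c B x y * g y := by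
  classical
  -- `g` agrees off `B` with the combination `Σ_{y ∉ B} g y · δ_y`
  have hoff : ∀ z, z ∉ B → g z = ∑ y ∈ univ.filter (fun y => y ∉ B), g y * (if z = y then (1 : ℝ) else 0) := by
    intro z hz
    rw [Finset.sum_eq_single z]
    · simp
    · intro y _ hyz
      rw [if_neg (Ne.symm hyz), mul_zero]
    · intro h
      exact absurd (Finset.mem_filter.mpr ⟨Finset.mem_univ z, hz⟩) h
  rw [harmExt_congr_off src tgt c B w₀ hw₀0 hw₀ g _ hoff,
    harmExt_sum src tgt c B w₀ hw₀0 hw₀ (univ.filter fun y => y ∉ B) g (fun y z => if z = y then (1 : ℝ) else 0)]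
  refine Finset.sum_congr rfl fun y _ => ?_
  rw [poisson, mul_comm]

/-- **TOTAL MASS ONE**: `Σ_{y ∉ B} poisson B x y = 1`. [folklore] -/
theorem sum_poisson_eq_one (x : St) : ∑ y ∈ univ.filter (fun y => y ∉ B), poisson src tgt c B x y = 1 := by
  have h := harmExt_eq_sum_poisson src tgt c B w₀ hw₀0 hw₀ (fun _ => (1 : ℝ)) x
  rw [harmExt_const src tgt c B w₀ hw₀0 hw₀] at h
  simp only [mul_one] at h
  exact h.symm

/-- **SUPPORT ON THE EXTERIOR BOUNDARY**: if no bond joins the exterior site `y` to a site of `B`, then `poisson B x y = 0` for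
every `x ∈ B` (the indicator `δ_y` is then itself harmonic on `B`). [folklore] -/
theorem poisson_eq_zero_of_not_adj (x y : St) (hx : x ∈ B) (hy : y ∉ B)
    (hadj : ∀ b : Bd, ¬ (src b ∈ B ∧ tgt b = y) ∧ ¬ (tgt b ∈ B ∧ src b = y)) : poisson src tgt c B x y = 0 := by
  classical
  have hδ : (fun z => if z = y then (1 : ℝ) else 0) = harmExt src tgt c B (fun z => if z = y then (1 : ℝ) else 0) := by
    refine harmExt_unique src tgt c B w₀ hw₀0 hw₀ _ _ (fun z _ => rfl) (fun z hz => ?_)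
    have hzy : z ≠ y := fun h => hy (h ▸ hz)
    rw [if_neg hzy, mul_zero]
    symm
    refine add_eq_zero_iff_of_nonneg (Finset.sum_nonneg fun b _ => mul_nonneg (sq_nonneg _) (by positivity))
      (Finset.sum_nonneg fun b _ => mul_nonneg (sq_nonneg _) (by positivity)) |>.mpr ⟨?_, ?_⟩
    · refine Finset.sum_eq_zero fun b hb => ?_
      have hb' := (Finset.mem_filter.mp hb).2
      rw [if_neg (fun h => (hadj b).2 ⟨hb' ▸ hz, h⟩), mul_zero]
    · refine Finset.sum_eq_zero fun b hb => ?_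
      have hb' := (Finset.mem_filter.mp hb).2
      rw [if_neg (fun h => (hadj b).1 ⟨hb' ▸ hz, h⟩), mul_zero]
  rw [poisson, ← hδ]
  simp only
  rw [if_neg]
  rintro rfl
  exact hy hx

end Kernel

/-! ## §4 DOMINATION of sub-solutions by the Poisson integral of their exterior values -/

section Domination

variable (B : Finset St) (w₀ : St → ℝ) (hw₀0 : ∀ y, 0 ≤ w₀ y)
    (hw₀ : ∀ x ∈ B, 1 + ((∑ b ∈ univ.filter (fun b => tgt b = x), c b ^ 2 * w₀ (src b)) +
        ∑ b ∈ univ.filter (fun b => src b = x), c b ^ 2 * w₀ (tgt b)) ≤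
      ((∑ b ∈ univ.filter (fun b => tgt b = x), c b ^ 2) + ∑ b ∈ univ.filter (fun b => src b = x), c b ^ 2) * w₀ x)

include hw₀0 hw₀

/-- **A SUB-SOLUTION LIES BELOW THE HARMONIC EXTENSION OF ITS OWN EXTERIOR VALUES**: `W·z ≤ Nz` on `B` ⟹ `z ≤ harmExt B z`
(`z − harmExt B z` is a zero-source sub-solution vanishing off `B`; §1). [folklore] -/
theorem subsolution_le_harmExt (z : St → ℝ)
    (hz : ∀ x ∈ B, ((∑ b ∈ univ.filter (fun b => tgt b = x), c b ^ 2) + ∑ b ∈ univ.filter (fun b => src b = x), c b ^ 2) * z x ≤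
      ((∑ b ∈ univ.filter (fun b => tgt b = x), c b ^ 2 * z (src b)) + ∑ b ∈ univ.filter (fun b => src b = x), c b ^ 2 * z (tgt b)))
    (x : St) : z x ≤ harmExt src tgt c B z x := by
  have h := nonpos_of_subsolution_unit src tgt c B w₀ hw₀0 hw₀ (fun y => z y - harmExt src tgt c B z y) (fun y hy => ?_)
    (fun y hy => by rw [harmExt_eq_off src tgt c B w₀ hw₀0 hw₀ z y hy, sub_self]) x
  · linarith
  · rw [nb_sub src tgt c z (harmExt src tgt c B z) y, mul_sub, harmExt_harmonic src tgt c B w₀ hw₀0 hw₀ z y hy]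
    linarith [hz y hy]

/-- **DOMINATION BY THE POISSON INTEGRAL**: `W·z ≤ Nz` on `B` ⟹ `z(x) ≤ Σ_{y ∉ B} poisson B x y · z(y)` — the sub-solution is
dominated by the Poisson average of its exterior values (with a POINTWISE bound `poisson ≤ K` on the columns that matter this is
`z(x) ≤ K·Σ_{∂B} z` for `z ≥ 0`: the input of the radius-averaging step). [folklore] -/
theorem subsolution_le_poisson_sum (z : St → ℝ)
    (hz : ∀ x ∈ B, ((∑ b ∈ univ.filter (fun b => tgt b = x), c b ^ 2) + ∑ b ∈ univ.filter (fun b => src b = x), c b ^ 2) * z x ≤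
      ((∑ b ∈ univ.filter (fun b => tgt b = x), c b ^ 2 * z (src b)) + ∑ b ∈ univ.filter (fun b => src b = x), c b ^ 2 * z (tgt b)))
    (x : St) : z x ≤ ∑ y ∈ univ.filter (fun y => y ∉ B), poisson src tgt c B x y * z y := by
  rw [← harmExt_eq_sum_poisson src tgt c B w₀ hw₀0 hw₀ z x]
  exact subsolution_le_harmExt src tgt c B w₀ hw₀0 hw₀ z hz x

/-- **DOMINATION WITH A POINTWISE KERNEL BOUND**: if moreover `z ≥ 0` off `B` and `poisson B x y ≤ K` for every `y ∉ B`, then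
`z(x) ≤ K·Σ_{y ∉ B} z(y)` — the shape in which a harmonic-measure bound `K ≍ s^{1−d}` is consumed. [folklore] -/
theorem subsolution_le_mul_sum (z : St → ℝ) (hz0 : ∀ y, y ∉ B → 0 ≤ z y)
    (hz : ∀ x ∈ B, ((∑ b ∈ univ.filter (fun b => tgt b = x), c b ^ 2) + ∑ b ∈ univ.filter (fun b => src b = x), c b ^ 2) * z x ≤
      ((∑ b ∈ univ.filter (fun b => tgt b = x), c b ^ 2 * z (src b)) + ∑ b ∈ univ.filter (fun b => src b = x), c b ^ 2 * z (tgt b)))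
    (x : St) {K : ℝ} (hK : ∀ y, y ∉ B → poisson src tgt c B x y ≤ K) :
    z x ≤ K * ∑ y ∈ univ.filter (fun y => y ∉ B), z y := by
  refine (subsolution_le_poisson_sum src tgt c B w₀ hw₀0 hw₀ z hz x).trans ?_
  rw [Finset.mul_sum]
  exact Finset.sum_le_sum fun y hy => mul_le_mul_of_nonneg_right (hK y (Finset.mem_filter.mp hy).2)
    (hz0 y (Finset.mem_filter.mp hy).2)

end Domination

/-! ## §5 Witness (non-vacuity): one bond `false → true` of weight `1`, `B = {true}` -/

/-- WITNESS.  Two sites, one bond `false → true` of weight `1`, `B = {true}` (`W(true) = 1`, `(Nu)(true) = u(false)`; the unit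
supersolution `w₀ = (false ↦ 0, true ↦ 1)`): the harmonic extension of any datum `g` is the constant `g(false)`, so
`poisson B true false = 1`. [folklore] -/
example (g : Bool → ℝ) : harmExt (St := Bool) (Bd := Unit) (fun _ => false) (fun _ => true) (fun _ => (1 : ℝ)) {true} g =
    fun _ => g false := by
  symm
  refine harmExt_unique (St := Bool) (Bd := Unit) (fun _ => false) (fun _ => true) (fun _ => (1 : ℝ)) {true}
    (fun y => if y then 1 else 0) (fun y => by cases y <;> simp)
    (fun x hx => by
      rw [Finset.mem_singleton] at hx
      subst hx
      simp)
    g _ (fun x hx => ?_) (fun x hx => ?_)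
  · have : x = false := by
      cases x
      · rfl
      · exact absurd (Finset.mem_singleton_self _) hx
    subst this
    rfl
  · rw [Finset.mem_singleton] at hx
    subst hx
    simp

end

end Summit.QuantumFields.BalabanUV.Beta.GraphPoissonKernel
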